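import Mathlib
import Summits.Ventures.PercRepro.TriangleCapOneTriangleC

/-!
# PercRepro — THE ONE-TRIANGLE CASE OF THE DENSE-CORNER STABILITY, and the dense-corner stability for `k ≥ 10`
(p3, gen 34; part 33d)

* **`one_triangle_stability`** — a `K₄⁻`-free graph on `k ≥ 10` vertices with `m ≥ 2k − 3` edges whose triangles
  all lie on `{u, v, w}` (and `u v w` is a triangle) has `Σ_v d(v)² + (k − 2) ≤ m·k`;
* **`dense_stability`** — THE DENSE-CORNER STABILITY FOR `k ≥ 10`: every `K₄⁻`-free graph on `k ≥ 10` vertices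
  with `m ≥ 2k − 3` edges that is not complete bipartite spanning has `Σ_v d(v)² + (k − 2) ≤ m·k`, i.e.
  `2·Σ_v C(d(v), 2) ≤ (m − 1)(k − 2)` (`dense_stability_cherries`).

The proof of the one-triangle case (P3-TRIANGLE-CAP.md §10at(d)): the deficit sum is the far-pair sum
`Σ_z far z`; an outer vertex is far from the six triangle pairs, a private neighbour `z` of `u` from `2` plus
twice the non-neighbours of `z` among the private neighbours of `v` and `w`, and `u` from every ordered pair between
the private neighbourhoods of `v` and `w`; with the cross-pair count this gives
`Σ deficit ≥ 2(a + b + c) + 6q + 2(ab + bc + ca)` (`a, b, c, q` = the sizes of the private neighbourhoods and of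
the outer set, `a + b + c + q + 3 = k`), so that `Σ_v d(v)² + (k − 2) ≤ m·k` as soon as `2q + ab + bc + ca ≥ 4`;
otherwise two of the private neighbourhoods are empty and at most one vertex is outer, which forces
`2m + 10 ≤ 4k` — outside the dense corner.  Axioms: standard.
-/

namespace PercRepro

namespace TriangleCap

namespace C047

open Finset

variable {V : Type*} [Fintype V] [DecidableEq V]

/-- **THE ONE-TRIANGLE CASE.** -/
theorem one_triangle_stability (D : SimpleGraph V) [DecidableRel D.Adj] (hK : K4mFree D)
    (hk : 10 ≤ Fintype.card V) {u v w : V} (huv : D.Adj u v) (huw : D.Adj u w) (hvw : D.Adj v w)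
    (hT : ∀ a b c, D.Adj a b → D.Adj a c → D.Adj b c → a = u ∨ a = v ∨ a = w)
    (hm : 2 * Fintype.card V ≤ D.edgeFinset.card + 3) :
    ∑ v, deg D v * deg D v + (Fintype.card V - 2) ≤ D.edgeFinset.card * Fintype.card V := by
  have hpart := card_partition_triangle D hK huv huw hvw
  have hvu : D.Adj v u := huv.symm
  have hwu : D.Adj w u := huw.symm
  have hwv : D.Adj w v := hvw.symm
  -- the pointwise far-pair bound
  have hL : ∀ z, (if z = u then cross D (priv D v u w) (priv D w u v) else 0) +
      (if z = v then cross D (priv D u v w) (priv D w u v) else 0) +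
      (if z = w then cross D (priv D u v w) (priv D v u w) else 0) +
      (if z ∈ priv D u v w then 2 + 2 * ((priv D v u w).filter (fun y => ¬ D.Adj z y)).card +
        2 * ((priv D w u v).filter (fun y => ¬ D.Adj z y)).card else 0) +
      (if z ∈ priv D v u w then 2 + 2 * ((priv D u v w).filter (fun y => ¬ D.Adj z y)).card +
        2 * ((priv D w u v).filter (fun y => ¬ D.Adj z y)).card else 0) +
      (if z ∈ priv D w u v then 2 + 2 * ((priv D u v w).filter (fun y => ¬ D.Adj z y)).card +
        2 * ((priv D v u w).filter (fun y => ¬ D.Adj z y)).card else 0) +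
      (if z ∈ outer D u v w then 6 else 0) ≤ far D z := by
    intro z
    rcases classify_triangle D hK huv huw hvw z with rfl | rfl | rfl | hz | hz | hz | hz
    · have h1 : z ∉ priv D z v w := by rw [mem_priv]; exact fun h => h.1.ne rfl
      have h2 : z ∉ priv D v z w := by rw [mem_priv]; exact fun h => h.2.2 hwu
      have h3 : z ∉ priv D w z v := by rw [mem_priv]; exact fun h => h.2.2 hvu
      have h4 : z ∉ outer D z v w := by rw [mem_outer]; exact fun h => h.2.1 hvu
      simp only [if_true, if_neg huv.ne, if_neg huw.ne, if_neg h1, if_neg h2, if_neg h3, if_neg h4,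
        add_zero]
      exact far_ge_cross D z v w
    · have h1 : z ∉ priv D u z w := by rw [mem_priv]; exact fun h => h.2.2 hwv
      have h2 : z ∉ priv D z u w := by rw [mem_priv]; exact fun h => h.1.ne rfl
      have h3 : z ∉ priv D w u z := by rw [mem_priv]; exact fun h => h.2.1 huv
      have h4 : z ∉ outer D u z w := by rw [mem_outer]; exact fun h => h.1 huv
      simp only [if_true, if_neg huv.ne.symm, if_neg hvw.ne, if_neg h1, if_neg h2, if_neg h3, if_neg h4,
        add_zero, zero_add]
      have := far_ge_cross D z u w
      rw [priv_comm D w z u] at this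
      exact this
    · have h1 : z ∉ priv D u v z := by rw [mem_priv]; exact fun h => h.2.1 hvw
      have h2 : z ∉ priv D v u z := by rw [mem_priv]; exact fun h => h.2.1 huw
      have h3 : z ∉ priv D z u v := by rw [mem_priv]; exact fun h => h.1.ne rfl
      have h4 : z ∉ outer D u v z := by rw [mem_outer]; exact fun h => h.1 huw
      simp only [if_true, if_neg huw.ne.symm, if_neg hvw.ne.symm, if_neg h1, if_neg h2, if_neg h3,
        if_neg h4, add_zero, zero_add]
      have := far_ge_cross D z u v
      rw [priv_comm D u z v, priv_comm D v z u] at this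
      exact this
    · have hz' := (mem_priv D u v w z).mp hz
      have hzu : z ≠ u := fun h => hz'.1.ne h.symm
      have hzv : z ≠ v := fun h => hz'.2.2 (h ▸ hwv)
      have hzw : z ≠ w := fun h => hz'.2.1 (h ▸ hvw)
      have h2 : z ∉ priv D v u w := by rw [mem_priv]; exact fun h => hz'.2.1 h.1
      have h3 : z ∉ priv D w u v := by rw [mem_priv]; exact fun h => hz'.2.2 h.1
      have h4 : z ∉ outer D u v w := by rw [mem_outer]; exact fun h => h.1 hz'.1
      simp only [if_neg hzu, if_neg hzv, if_neg hzw, if_pos hz, if_neg h2, if_neg h3, if_neg h4,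
        add_zero, zero_add]
      exact far_ge_of_mem_priv D huv huw hvw hz
    · have hz' := (mem_priv D v u w z).mp hz
      have hzu : z ≠ u := fun h => hz'.2.2 (h ▸ hwu)
      have hzv : z ≠ v := fun h => hz'.1.ne h.symm
      have hzw : z ≠ w := fun h => hz'.2.1 (h ▸ huw)
      have h1 : z ∉ priv D u v w := by rw [mem_priv]; exact fun h => hz'.2.1 h.1
      have h3 : z ∉ priv D w u v := by rw [mem_priv]; exact fun h => hz'.2.2 h.1
      have h4 : z ∉ outer D u v w := by rw [mem_outer]; exact fun h => h.2.1 hz'.1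
      simp only [if_neg hzu, if_neg hzv, if_neg hzw, if_neg h1, if_pos hz, if_neg h3, if_neg h4,
        add_zero, zero_add]
      have := far_ge_of_mem_priv D hvu hvw huw hz
      rw [priv_comm D w v u] at this
      exact this
    · have hz' := (mem_priv D w u v z).mp hz
      have hzu : z ≠ u := fun h => hz'.2.2 (h ▸ hvu)
      have hzv : z ≠ v := fun h => hz'.2.1 (h ▸ huv)
      have hzw : z ≠ w := fun h => hz'.1.ne h.symm
      have h1 : z ∉ priv D u v w := by rw [mem_priv]; exact fun h => hz'.2.1 h.1
      have h2 : z ∉ priv D v u w := by rw [mem_priv]; exact fun h => hz'.2.2 h.1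
      have h4 : z ∉ outer D u v w := by rw [mem_outer]; exact fun h => h.2.2 hz'.1
      simp only [if_neg hzu, if_neg hzv, if_neg hzw, if_neg h1, if_neg h2, if_pos hz, if_neg h4,
        add_zero, zero_add]
      have := far_ge_of_mem_priv D hwu hwv huv hz
      rw [priv_comm D u w v, priv_comm D v w u] at this
      exact this
    · have hz' := (mem_outer D u v w z).mp hz
      have hzu : z ≠ u := fun h => hz'.2.1 (h ▸ hvu)
      have hzv : z ≠ v := fun h => hz'.1 (h ▸ huv)
      have hzw : z ≠ w := fun h => hz'.1 (h ▸ huw)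
      have h1 : z ∉ priv D u v w := by rw [mem_priv]; exact fun h => hz'.1 h.1
      have h2 : z ∉ priv D v u w := by rw [mem_priv]; exact fun h => hz'.2.1 h.1
      have h3 : z ∉ priv D w u v := by rw [mem_priv]; exact fun h => hz'.2.2 h.1
      simp only [if_neg hzu, if_neg hzv, if_neg hzw, if_neg h1, if_neg h2, if_neg h3, if_pos hz,
        zero_add]
      exact far_ge_six_of_mem_outer D huv huw hvw hz
  have hsum := sum_le_sum (fun z (_ : z ∈ univ) => hL z)
  rw [← sum_deficit_eq_sum_far] at hsum
  simp only [sum_add_distrib, sum_ite_eq', mem_univ, if_true, sum_ite_mem, univ_inter, sum_const,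
    smul_eq_mul, ← mul_sum] at hsum
  -- the cross-pair counts
  have d1 : Disjoint (priv D v u w) (priv D w u v) := by
    rw [disjoint_left]; intro y h1 h2; rw [mem_priv] at h1 h2; exact h2.2.2 h1.1
  have d2 : Disjoint (priv D u v w) (priv D w u v) := by
    rw [disjoint_left]; intro y h1 h2; rw [mem_priv] at h1 h2; exact h2.2.1 h1.1
  have d3 : Disjoint (priv D u v w) (priv D v u w) := by
    rw [disjoint_left]; intro y h1 h2; rw [mem_priv] at h1 h2; exact h2.2.1 h1.1
  have c1 := cross_add_sum_ge D _ _ d1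
  have c2 := cross_add_sum_ge D _ _ d2
  have c3 := cross_add_sum_ge D _ _ d3
  have hid := two_mul_sum_deg_sq_add_sum_deficit D
  have hT6 := card_triangles3_le_six D hT
  -- names
  set a := (priv D u v w).card with ha
  set b := (priv D v u w).card with hb
  set c := (priv D w u v).card with hc
  set q := (outer D u v w).card with hq
  have hF : 2 * a + 2 * b + 2 * c + 6 * q + 2 * (b * c) + 2 * (a * c) + 2 * (a * b) ≤
      ∑ p ∈ adjPairsAll D, deficit D p := by omega
  obtain ⟨t, ht⟩ : ∃ t, Fintype.card V = t + 2 := ⟨Fintype.card V - 2, by omega⟩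
  have e : Fintype.card V - 2 = t := by omega
  rw [e]
  have hmk : 2 * (D.edgeFinset.card * Fintype.card V) = 2 * D.edgeFinset.card * Fintype.card V := by ring
  -- the main case: `2q + ab + bc + ca ≥ 4`
  have main : 4 ≤ 2 * q + (b * c + a * c + a * b) →
      ∑ v, deg D v * deg D v + t ≤ D.edgeFinset.card * Fintype.card V := by
    intro h4
    omega
  by_cases hq2 : 2 ≤ q
  · exact main (by omega)
  have hq1 : q ≤ 1 := by omega
  by_cases hbc : 1 ≤ b ∧ 1 ≤ c
  · apply main
    have h1 : a ≤ a * b := Nat.le_mul_of_pos_right a hbc.1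
    have h2 : a ≤ a * c := Nat.le_mul_of_pos_right a hbc.2
    have h3 : b + c ≤ b * c + 1 := mul_ge_add_sub_one b c hbc.1 hbc.2
    omega
  by_cases hac : 1 ≤ a ∧ 1 ≤ c
  · apply main
    have h1 : b ≤ b * c := Nat.le_mul_of_pos_right b hac.2
    have h2 : b ≤ a * b := Nat.le_mul_of_pos_left b hac.1
    have h3 : a + c ≤ a * c + 1 := mul_ge_add_sub_one a c hac.1 hac.2
    omega
  by_cases hab : 1 ≤ a ∧ 1 ≤ b
  · apply main
    have h1 : c ≤ b * c := Nat.le_mul_of_pos_left c hab.2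
    have h2 : c ≤ a * c := Nat.le_mul_of_pos_left c hab.1
    have h3 : a + b ≤ a * b + 1 := mul_ge_add_sub_one a b hab.1 hab.2
    omega
  -- the sparse exception: two private neighbourhoods are empty
  exfalso
  have hk5 : 5 ≤ Fintype.card V := by omega
  have hcases : (b = 0 ∧ c = 0) ∨ (a = 0 ∧ c = 0) ∨ (a = 0 ∧ b = 0) := by omega
  rcases hcases with ⟨hb0, hc0⟩ | ⟨ha0, hc0⟩ | ⟨ha0, hb0⟩
  · have hv : priv D v u w = ∅ := card_eq_zero.mp hb0
    have hw : priv D w u v = ∅ := card_eq_zero.mp hc0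
    have := sparse_of_priv_empty D hK huv huw hvw hT hv hw hq1 hk5
    omega
  · have hT' : ∀ x y z, D.Adj x y → D.Adj x z → D.Adj y z → x = v ∨ x = u ∨ x = w := by
      intro x y z h1 h2 h3
      rcases hT x y z h1 h2 h3 with h | h | h
      · exact Or.inr (Or.inl h)
      · exact Or.inl h
      · exact Or.inr (Or.inr h)
    have hv' : priv D u v w = ∅ := card_eq_zero.mp ha0
    have hw' : priv D w v u = ∅ := by rw [priv_comm]; exact card_eq_zero.mp hc0
    have hq' : (outer D v u w).card ≤ 1 := by rw [← outer_comm₁]; exact hq1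
    have := sparse_of_priv_empty D hK hvu hvw huw hT' hv' hw' hq' hk5
    omega
  · have hT' : ∀ x y z, D.Adj x y → D.Adj x z → D.Adj y z → x = w ∨ x = u ∨ x = v := by
      intro x y z h1 h2 h3
      rcases hT x y z h1 h2 h3 with h | h | h
      · exact Or.inr (Or.inl h)
      · exact Or.inr (Or.inr h)
      · exact Or.inl h
    have hv' : priv D u w v = ∅ := by rw [priv_comm]; exact card_eq_zero.mp ha0
    have hw' : priv D v w u = ∅ := by rw [priv_comm]; exact card_eq_zero.mp hb0
    have hq' : (outer D w u v).card ≤ 1 := by rw [← outer_comm₂]; exact hq1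
    have := sparse_of_priv_empty D hK hwu hwv huv hT' hv' hw' hq' hk5
    omega

/-- Two distinct triangles give at least twelve ordered triangles: if some triangle has a vertex outside
`{u, v, w}` then `12 ≤ |T₃|`. -/
theorem twelve_le_card_triangles3 (D : SimpleGraph V) [DecidableRel D.Adj]
    {u v w : V} (huv : D.Adj u v) (huw : D.Adj u w) (hvw : D.Adj v w) {a b c : V} (hab : D.Adj a b)
    (hac : D.Adj a c) (hbc : D.Adj b c) (ha : ¬ (a = u ∨ a = v ∨ a = w)) :
    12 ≤ (triangles3 D).card := by
  have hau : a ≠ u := fun h => ha (Or.inl h)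
  have hav : a ≠ v := fun h => ha (Or.inr (Or.inl h))
  have haw : a ≠ w := fun h => ha (Or.inr (Or.inr h))
  have huv' := huv.ne
  have huw' := huw.ne
  have hvw' := hvw.ne
  have hab' := hab.ne
  have hac' := hac.ne
  have hbc' := hbc.ne
  have hsub : ({((u, v), w), ((v, w), u), ((w, u), v), ((v, u), w), ((u, w), v), ((w, v), u),
      ((a, b), c), ((b, c), a), ((c, a), b), ((b, a), c), ((a, c), b), ((c, b), a)} :
        Finset ((V × V) × V)) ⊆ triangles3 D := by
    intro t ht
    simp only [mem_insert, mem_singleton] at ht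
    rw [mem_triangles3]
    rcases ht with rfl | rfl | rfl | rfl | rfl | rfl | rfl | rfl | rfl | rfl | rfl | rfl
    · exact ⟨huv, huw, hvw⟩
    · exact ⟨hvw, huv.symm, huw.symm⟩
    · exact ⟨huw.symm, hvw.symm, huv⟩
    · exact ⟨huv.symm, hvw, huw⟩
    · exact ⟨huw, huv, hvw.symm⟩
    · exact ⟨hvw.symm, huw.symm, huv.symm⟩
    · exact ⟨hab, hac, hbc⟩
    · exact ⟨hbc, hab.symm, hac.symm⟩
    · exact ⟨hac.symm, hbc.symm, hab⟩
    · exact ⟨hab.symm, hbc, hac⟩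
    · exact ⟨hac, hab, hbc.symm⟩
    · exact ⟨hbc.symm, hac.symm, hab.symm⟩
  refine le_trans ?_ (card_le_card hsub)
  rw [card_insert_of_notMem, card_insert_of_notMem, card_insert_of_notMem, card_insert_of_notMem,
    card_insert_of_notMem, card_insert_of_notMem, card_insert_of_notMem, card_insert_of_notMem,
    card_insert_of_notMem, card_insert_of_notMem, card_insert_of_notMem, card_singleton]
  all_goals simp [huv', huw', hvw', hab', hac', hbc', huv'.symm, huw'.symm, hvw'.symm,
    hab'.symm, hac'.symm, hbc'.symm, hau.symm, hav.symm, haw.symm]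

end C047

end TriangleCap

end PercRepro
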